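import Literature.NumberTheory.ComplexMultiplication.DadeTausskyZassenhausCubicClassNumbers
import HarnessLib

/-!
# HL26b §8 for `β³ + 2β² + 2β + 2 = 0`: the full lattices with order `Λ₃ = ⟨1, 2β, 2β²⟩` are `Λ₃` and `L₃ = ⟨1, β, 2β²⟩`
# up to multiplication by `K^×` — `#{[L]_ε | 𝒪(L) = Λ₃} = 2` (`τ₃ = 2`)

Hertling–Larabi [HL26b, §8, chunk p0024]: «We will determine `τ_3` with Theorem 5.7 [Faddeev]. […] So `τ_3 = 2`. One
element in the `w`-class of non-invertible full lattices `L` with `𝒪(L) = Λ_3` can be found with Dedekind's observation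
Lemma 4.6, namely `L_3 := ⟨1, β, 2β²⟩_ℤ` (8.1). `L_3` satisfies `1 ∈ L_3 ⊊ Λ_1` and `L_3² = Λ_1`, so `L_3` is not
invertible by Lemma 4.6. One sees easily `𝒪(L_3) = Λ_3`, so `{[L]_w | L ∈ 𝓛(A), 𝒪(L) = Λ_3} = {[Λ_3]_w, [L_3]_w}`.»
With `|G([Λ_3]_ε)| = 1` (`natCard_pic_span₃_eq_one`) this is `{[L]_ε | 𝒪(L) = Λ_3} = {[Λ_3]_ε, [L_3]_ε}`, two classes.

HL obtain `τ_3 = 2` from Faddeev's count `τ = 2^t` (Theorem 5.7, [Fa65-2], not in the tree).  THIS FILE PROVES THE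
TWO-CLASS STATEMENT DIRECTLY, by a finite argument at the conductor `C_3 = 2Λ_1`: for a full lattice `L` with
`𝒪(L) = Λ_3`, the invertible `Λ_1`-lattice `LΛ_1` is principal (`exists_units_smul_span₁_eq`, class number one), so after
scaling `LΛ_1 = Λ_1` and `2Λ_1 ⊆ L ⊆ Λ_1`; then `L` is the preimage of an additive subgroup `V` of
`Λ_1/2Λ_1 = 𝔽_2[β]/(β³)` (coordinates mod `2`) with `VΛ_1 = Λ_1/2Λ_1` and stabiliser `{r | rV ⊆ V} = 𝔽_2` (because
`𝒪(L) = Λ_3 = ℤ + 2Λ_1`), and a `decide` over the `2⁸` subsets shows that a unit `(1+β)^k`, `k ∈ {0, 1, 2, 3}` — the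
residues of `Λ_1^{unit} = ±(β+1)^ℤ` fill `(𝔽_2[β]/(β³))^{unit}` — carries `V` to `𝔽_2·1` (`L ↦ Λ_3`) or to
`𝔽_2 + 𝔽_2β` (`L ↦ L_3`).

## Contents
* §1 `not_invertible_spanL₃` («`L_3` is not invertible»: an invertible `L ∋ 1` with `𝒪(L) = Λ_3` and `L² = Λ_1` would be
  a `Λ_1`-module), `not_exists_units_smul_span₃_eq_spanL₃` (`[Λ_3]_ε ≠ [L_3]_ε`).
* §2 **`exists_units_smul_eq_span₃_or_spanL₃`**: every full `L` with `𝒪(L) = Λ_3` is `u·Λ_3` or `u·L_3`-equivalent: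
  `∃ u ∈ K^{unit}, uL = Λ_3 ∨ uL = L_3`.
* §3 **`natCard_quot_span₃_eq_two`**: `#{[L]_ε | 𝒪(L) = Λ_3} = 2`; with `natCard_quot_span₁/₂_eq_one`, `natCard_quot_span₄_eq_two`
  (`…CubicClassNumbers`) all six classes `[Λ_1], [Λ_2], [Λ_3], [L_3], [Λ_4], [L_4]` of HL §8 are accounted for.

## References
* [HL26b] C. Hertling, K. Larabi, arXiv:2602.15748 (2026), §8 (8.1) and the `τ_3` computation, chunk p0024; §4
  Lemma 4.6 (Dedekind). [HertlingLarabi2026b]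
-/

noncomputable section

open scoped Pointwise
open Polynomial Module NumberField Submodule

namespace Literature.NumberTheory.ComplexMultiplication.FiniteQAlgebraLattice.DTZCubic

open Literature.NumberTheory.NumberFields
open Literature.NumberTheory.Automorphic (IsFullLattice mem_units_smul_submodule_iff)

variable {K : Type} [Field K] [NumberField K] {θ : K}

/-! ## §1 `L₃` is not invertible; `[Λ₃]_ε ≠ [L₃]_ε` -/

omit [NumberField K] in
/-- An order is idempotent: `Λ₃Λ₃ = Λ₃`. [cite: HertlingLarabi2026b, §8 Lemma 8.1 («`Λ_3 = ⟨1, 2β, 2β²⟩_ℤ`» is an order), chunk p0024] -/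
private theorem span₃_mul_self (hθ : aeval θ (MonicCubic.poly 2 2 2) = 0) :
    span ℤ ({1, 2 * θ, 2 * θ ^ 2} : Set K) * span ℤ ({1, 2 * θ, 2 * θ ^ 2} : Set K) =
      span ℤ ({1, 2 * θ, 2 * θ ^ 2} : Set K) :=
  le_antisymm (span₃_mul_le (theta_rel_two hθ)) fun x hx => by
    simpa only [mul_one] using mul_mem_mul hx (one_mem_span₃ θ)

/-- **«`L_3` satisfies `1 ∈ L_3 ⊊ Λ_1` and `L_3² = Λ_1`, so `L_3` is not invertible»**: `L₃·(𝒪(L₃):L₃) ≠ 𝒪(L₃)` —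
were `L₃M = Λ₃` (`M = Λ₃:L₃`), then `Λ₁M² = L₃²M² = Λ₃² = Λ₃` would be a `Λ₁`-module, but `β ∉ Λ₃`.
[cite: HertlingLarabi2026b, §8 (8.1) and §4 Lemma 4.6, chunk p0024] -/
theorem not_invertible_spanL₃ (hθ : aeval θ (MonicCubic.poly 2 2 2) = 0) (h3 : finrank ℚ K = 3) :
    span ℤ ({1, θ, 2 * θ ^ 2} : Set K) * ((span ℤ ({1, θ, 2 * θ ^ 2} : Set K) / span ℤ ({1, θ, 2 * θ ^ 2} : Set K)) /
        span ℤ ({1, θ, 2 * θ ^ 2} : Set K)) ≠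
      span ℤ ({1, θ, 2 * θ ^ 2} : Set K) / span ℤ ({1, θ, 2 * θ ^ 2} : Set K) := by
  have hβ := theta_rel_two hθ
  have hli := linearIndependent_one_theta_sq hθ h3
  rw [spanL₃_div_spanL₃ hβ hli]
  intro h
  have hsq : span ℤ ({1, θ, θ ^ 2} : Set K) *
      ((span ℤ ({1, 2 * θ, 2 * θ ^ 2} : Set K) / span ℤ ({1, θ, 2 * θ ^ 2} : Set K)) *
        (span ℤ ({1, 2 * θ, 2 * θ ^ 2} : Set K) / span ℤ ({1, θ, 2 * θ ^ 2} : Set K))) =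
      span ℤ ({1, 2 * θ, 2 * θ ^ 2} : Set K) := by
    rw [← spanL₃_mul_spanL₃ hβ, mul_mul_mul_comm, h, span₃_mul_self hθ]
  have h1 : (1 : K) ∈ span ℤ ({1, θ, θ ^ 2} : Set K) *
      ((span ℤ ({1, 2 * θ, 2 * θ ^ 2} : Set K) / span ℤ ({1, θ, 2 * θ ^ 2} : Set K)) *
        (span ℤ ({1, 2 * θ, 2 * θ ^ 2} : Set K) / span ℤ ({1, θ, 2 * θ ^ 2} : Set K))) := by
    rw [hsq]; exact one_mem_span₃ θ
  have hθ1 : θ ∈ span ℤ ({1, θ, θ ^ 2} : Set K) := subset_span (by simp)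
  have hθ3 : θ ∈ span ℤ ({1, 2 * θ, 2 * θ ^ 2} : Set K) := by
    have h' := mul_mem_mul hθ1 h1
    rw [mul_one, ← mul_assoc] at h'
    rw [← hsq]
    exact mul_le_mul' (span₁_mul_le hβ) le_rfl h'
  have h01 : ((0 : ℤ) : K) + (1 : ℤ) * θ + (0 : ℤ) * θ ^ 2 = θ := by push_cast; ring
  have h' : ((0 : ℤ) : K) + (1 : ℤ) * θ + (0 : ℤ) * θ ^ 2 ∈ span ℤ ({1, 2 * θ, 2 * θ ^ 2} : Set K) := by
    rw [h01]; exact hθ3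
  rw [mem_span₃_iff hli] at h'
  omega

/-- Scaling by a unit preserves invertibility, so **`[L₃]_ε ≠ [Λ₃]_ε`**: no `u ∈ K^{unit}` has `uΛ₃ = L₃`.
[cite: HertlingLarabi2026b, §8 («`[L_3]_ε`: not invertible», the table of the six classes), chunk p0025] -/
theorem not_exists_units_smul_span₃_eq_spanL₃ (hθ : aeval θ (MonicCubic.poly 2 2 2) = 0) (h3 : finrank ℚ K = 3) :
    ¬ ∃ u : Kˣ, u • span ℤ ({1, 2 * θ, 2 * θ ^ 2} : Set K) = span ℤ ({1, θ, 2 * θ ^ 2} : Set K) := by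
  rintro ⟨u, hu⟩
  have hβ := theta_rel_two hθ
  have hO : span ℤ ({1, 2 * θ, 2 * θ ^ 2} : Set K) / span ℤ ({1, 2 * θ, 2 * θ ^ 2} : Set K) =
      span ℤ ({1, 2 * θ, 2 * θ ^ 2} : Set K) := div_self_eq_of_one_mem (one_mem_span₃ θ) (span₃_mul_le hβ)
  have hinv : span ℤ ({1, 2 * θ, 2 * θ ^ 2} : Set K) *
      ((span ℤ ({1, 2 * θ, 2 * θ ^ 2} : Set K) / span ℤ ({1, 2 * θ, 2 * θ ^ 2} : Set K)) /
        span ℤ ({1, 2 * θ, 2 * θ ^ 2} : Set K)) =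
      span ℤ ({1, 2 * θ, 2 * θ ^ 2} : Set K) / span ℤ ({1, 2 * θ, 2 * θ ^ 2} : Set K) := by
    rw [hO, hO]; exact span₃_mul_self hθ
  have h := units_smul_mul_div_div_eq u hinv
  rw [hu] at h
  exact not_invertible_spanL₃ hθ h3 h

/-! ## §2 Every full lattice with order `Λ₃` is `K^{unit}`-equivalent to `Λ₃` or to `L₃` -/

omit [NumberField K] in
/-- Coefficient comparison in `Λ₁`. [folklore] -/
private theorem coeff_eq_zero₃ (hli : LinearIndependent ℤ ![(1 : K), θ, θ ^ 2]) {a b c : ℤ}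
    (h : (a : K) + b * θ + c * θ ^ 2 = 0) : a = 0 ∧ b = 0 ∧ c = 0 := by
  have H := Fintype.linearIndependent_iff.1 hli ![a, b, c] (by
    simpa [Fin.sum_univ_three, zsmul_eq_mul] using h)
  exact ⟨by simpa using H 0, by simpa using H 1, by simpa using H 2⟩

omit [NumberField K] in
/-- The prime `𝔭 = ⟨2, θ, θ²⟩ = (2, θ)` of `Λ₁` above `2`: `u + vθ + wθ² ∈ 𝔭 ⟺ 2 ∣ u`. [folklore] -/
private theorem mem_spanP_iff (hli : LinearIndependent ℤ ![(1 : K), θ, θ ^ 2]) (u v w : ℤ) :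
    (u : K) + v * θ + w * θ ^ 2 ∈ span ℤ ({2, θ, θ ^ 2} : Set K) ↔ 2 ∣ u := by
  constructor
  · intro h
    obtain ⟨a, b, c, habc⟩ := mem_span_triple.1 h
    simp only [zsmul_eq_mul] at habc
    obtain ⟨h1, -, -⟩ := coeff_eq_zero₃ hli (a := 2 * a - u) (b := b - v) (c := c - w)
      (by push_cast; linear_combination habc)
    exact ⟨a, by omega⟩
  · rintro ⟨k, rfl⟩
    exact mem_span_triple.2 ⟨k, v, w, by simp only [zsmul_eq_mul]; push_cast; ring⟩

omit [NumberField K] in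
/-- `𝔭Λ₁ ⊆ 𝔭` (`𝔭` is an ideal of `Λ₁ = ℤ[θ]`). [folklore] -/
private theorem spanP_mul_span₁_le (hθ : aeval θ (MonicCubic.poly 2 2 2) = 0)
    (hli : LinearIndependent ℤ ![(1 : K), θ, θ ^ 2]) :
    span ℤ ({2, θ, θ ^ 2} : Set K) * span ℤ ({1, θ, θ ^ 2} : Set K) ≤ span ℤ ({2, θ, θ ^ 2} : Set K) := by
  refine mul_le.2 fun x hx y hy => ?_
  have hxΛ : x ∈ span ℤ ({1, θ, θ ^ 2} : Set K) := by
    refine (span_le.2 ?_ : span ℤ ({2, θ, θ ^ 2} : Set K) ≤ span ℤ ({1, θ, θ ^ 2} : Set K)) hx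
    rintro z (rfl | rfl | rfl)
    · simpa using (span ℤ ({1, θ, θ ^ 2} : Set K)).smul_mem (2 : ℤ) (one_mem_span₁ θ)
    · exact subset_span (by simp)
    · exact subset_span (by simp)
  obtain ⟨u, v, w, rfl⟩ := exists_coords_of_mem_span₁ hxΛ
  obtain ⟨u', v', w', rfl⟩ := exists_coords_of_mem_span₁ hy
  obtain ⟨k, rfl⟩ := (mem_spanP_iff hli u v w).1 hx
  rw [coords_mul hθ, mem_spanP_iff hli]
  exact ⟨k * u' - (v * w' + w * v') + 2 * w * w', by ring⟩

/-- **The normalised case**: a lattice `L` with `LΛ₁ = Λ₁` and `𝒪(L) = Λ₃` is carried to `Λ₃` or to `L₃` by a unit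
`(θ+1)^k` of `Λ₁` — the finite classification of additive subgroups `V ⊆ Λ₁/2Λ₁ = 𝔽₂[θ]/(θ³)` with `VΛ₁ = Λ₁/2Λ₁` and
stabiliser `𝔽₂`, by `decide`. [cite: HertlingLarabi2026b, §8 («`{[L]_w | 𝒪(L) = Λ_3} = {[Λ_3]_w, [L_3]_w}`»), chunk p0024] -/
private theorem exists_units_smul_eq_of_mul_span₁_eq (hθ : aeval θ (MonicCubic.poly 2 2 2) = 0)
    (h3 : finrank ℚ K = 3) {L : Submodule ℤ K}
    (hLΛ : L * span ℤ ({1, θ, θ ^ 2} : Set K) = span ℤ ({1, θ, θ ^ 2} : Set K))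
    (hO : L / L = span ℤ ({1, 2 * θ, 2 * θ ^ 2} : Set K)) :
    ∃ u : Kˣ, u • L = span ℤ ({1, 2 * θ, 2 * θ ^ 2} : Set K) ∨ u • L = span ℤ ({1, θ, 2 * θ ^ 2} : Set K) := by
  have hβ := theta_rel_two hθ
  have hli := linearIndependent_one_theta_sq hθ h3
  -- (a) `L ⊆ Λ₁`
  have hsub : L ≤ span ℤ ({1, θ, θ ^ 2} : Set K) := fun x hx => by
    rw [← hLΛ]; simpa only [mul_one] using mul_mem_mul hx (one_mem_span₁ θ)
  -- (b) `2Λ₁ ⊆ L`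
  have h2 : ∀ y ∈ span ℤ ({1, θ, θ ^ 2} : Set K), (2 : K) * y ∈ L := by
    intro y hy
    rw [← hLΛ] at hy
    refine Submodule.mul_induction_on hy (fun m hm n hn => ?_) (fun x y hx hy => by rw [mul_add]; exact add_mem hx hy)
    obtain ⟨u, v, w, rfl⟩ := exists_coords_of_mem_span₁ hn
    have h2n : (2 : K) * ((u : K) + v * θ + w * θ ^ 2) ∈ L / L := by
      rw [hO, show (2 : K) * ((u : K) + v * θ + w * θ ^ 2) = ((2 * u : ℤ) : K) + ((2 * v : ℤ) : K) * θ +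
        ((2 * w : ℤ) : K) * θ ^ 2 by push_cast; ring, mem_span₃_iff hli]
      exact ⟨⟨v, rfl⟩, ⟨w, rfl⟩⟩
    have := mem_div_iff_forall_mul_mem.1 h2n m hm
    rw [show (2 : K) * (m * ((u : K) + v * θ + w * θ ^ 2)) = 2 * ((u : K) + v * θ + w * θ ^ 2) * m by ring]
    exact this
  -- (c) membership in `L` only depends on the coordinates mod `2`
  have hkey : ∀ u v w u' v' w' : ℤ, 2 ∣ u' - u → 2 ∣ v' - v → 2 ∣ w' - w →
      (u : K) + v * θ + w * θ ^ 2 ∈ L → (u' : K) + v' * θ + w' * θ ^ 2 ∈ L := by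
    rintro u v w u' v' w' ⟨a, ha⟩ ⟨b, hb⟩ ⟨c, hc⟩ h
    have hd : (u' : K) + v' * θ + w' * θ ^ 2 = ((u : K) + v * θ + w * θ ^ 2) + 2 * ((a : K) + b * θ + c * θ ^ 2) := by
      rw [show u' = u + 2 * a by omega, show v' = v + 2 * b by omega, show w' = w + 2 * c by omega]
      push_cast; ring
    rw [hd]
    exact add_mem h (h2 _ (mem_span_triple.2 ⟨a, b, c, by simp only [zsmul_eq_mul, mul_one]⟩))
  have hdvd : ∀ z z' : ℤ, ((z : ZMod 2) = (z' : ZMod 2)) → 2 ∣ z' - z := fun z z' h =>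
    (ZMod.intCast_eq_intCast_iff_dvd_sub z z' 2).1 h
  -- (d) the set of residues
  let V : Finset (ZMod 2 × ZMod 2 × ZMod 2) := @Finset.filter _
    (fun t => ∃ u v w : ℤ, (u : K) + v * θ + w * θ ^ 2 ∈ L ∧ ((u : ZMod 2), (v : ZMod 2), (w : ZMod 2)) = t)
    (Classical.decPred _) Finset.univ
  have hV : ∀ u v w : ℤ, (u : K) + v * θ + w * θ ^ 2 ∈ L ↔ ((u : ZMod 2), (v : ZMod 2), (w : ZMod 2)) ∈ V := by
    intro u v w
    simp only [V, Finset.mem_filter, Finset.mem_univ, true_and]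
    constructor
    · exact fun h => ⟨u, v, w, h, rfl⟩
    · rintro ⟨u', v', w', h', he⟩
      simp only [Prod.mk.injEq] at he
      obtain ⟨hu, hv, hw⟩ := he
      exact hkey u' v' w' u v w (hdvd _ _ hu) (hdvd _ _ hv) (hdvd _ _ hw) h'
  -- the product of `Λ₁/2Λ₁ = 𝔽₂[θ]/(θ³)` in coordinates (the formula `coords_mul`, read mod `2`)
  let mul : ZMod 2 × ZMod 2 × ZMod 2 → ZMod 2 × ZMod 2 × ZMod 2 → ZMod 2 × ZMod 2 × ZMod 2 := fun r t =>
    (r.1 * t.1 - 2 * (r.2.1 * t.2.2 + r.2.2 * t.2.1) + 4 * r.2.2 * t.2.2,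
     r.1 * t.2.1 + r.2.1 * t.1 - 2 * (r.2.1 * t.2.2 + r.2.2 * t.2.1) + 2 * r.2.2 * t.2.2,
     r.1 * t.2.2 + r.2.1 * t.2.1 + r.2.2 * t.1 - 2 * (r.2.1 * t.2.2 + r.2.2 * t.2.1) + 2 * r.2.2 * t.2.2)
  have hmulres : ∀ a b c u v w : ℤ,
      ((((a * u - 2 * (b * w + c * v) + 4 * c * w : ℤ)) : ZMod 2),
        (((a * v + b * u - 2 * (b * w + c * v) + 2 * c * w : ℤ)) : ZMod 2),
        (((a * w + b * v + c * u - 2 * (b * w + c * v) + 2 * c * w : ℤ)) : ZMod 2)) =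
      mul ((a : ZMod 2), (b : ZMod 2), (c : ZMod 2)) ((u : ZMod 2), (v : ZMod 2), (w : ZMod 2)) := by
    intro a b c u v w
    simp only [mul]
    push_cast
    exact Prod.ext rfl (Prod.ext rfl rfl)
  -- products: if `g = a + bθ + cθ² ∈ Λ₁` and `x = u + vθ + wθ²`, then `gx` has residue `mul (res g) (res x)`
  have hprod : ∀ a b c u v w : ℤ, ((a : K) + b * θ + c * θ ^ 2) * ((u : K) + v * θ + w * θ ^ 2) =
      ((a * u - 2 * (b * w + c * v) + 4 * c * w : ℤ) : K) +
        ((a * v + b * u - 2 * (b * w + c * v) + 2 * c * w : ℤ) : K) * θ +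
        ((a * w + b * v + c * u - 2 * (b * w + c * v) + 2 * c * w : ℤ) : K) * θ ^ 2 :=
    fun a b c u v w => coords_mul hθ a b c u v w
  -- (e) properties of `V`
  have hV0 : ((0 : ZMod 2), (0 : ZMod 2), (0 : ZMod 2)) ∈ V := by
    have h := (hV 0 0 0).1 (by simp)
    rw [Int.cast_zero] at h
    exact h
  have hVadd : ∀ t ∈ V, ∀ t' ∈ V, t + t' ∈ V := by
    intro t ht t' ht'
    simp only [V, Finset.mem_filter, Finset.mem_univ, true_and] at ht ht'
    obtain ⟨u, v, w, h, rfl⟩ := ht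
    obtain ⟨u', v', w', h', rfl⟩ := ht'
    have hs := (hV (u + u') (v + v') (w + w')).1 (by
      rw [show ((u + u' : ℤ) : K) + ((v + v' : ℤ) : K) * θ + ((w + w' : ℤ) : K) * θ ^ 2 =
        ((u : K) + v * θ + w * θ ^ 2) + ((u' : K) + v' * θ + w' * θ ^ 2) by push_cast; ring]
      exact add_mem h h')
    simpa only [Int.cast_add, Prod.mk_add_mk] using hs
  have hVunit : ∃ t ∈ V, t.1 = 1 := by
    by_contra hne
    push Not at hne
    -- then `L ⊆ 𝔭`, so `Λ₁ = LΛ₁ ⊆ 𝔭 ∌ 1`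
    have hLP : L ≤ span ℤ ({2, θ, θ ^ 2} : Set K) := fun x hx => by
      obtain ⟨u, v, w, rfl⟩ := exists_coords_of_mem_span₁ (hsub hx)
      have ht := (hV u v w).1 hx
      have hu : (u : ZMod 2) = 0 := by
        have h01 : ∀ z : ZMod 2, z ≠ 1 → z = 0 := by decide
        exact h01 _ (hne _ ht)
      exact (mem_spanP_iff hli u v w).2 ((ZMod.intCast_zmod_eq_zero_iff_dvd u 2).1 hu)
    have h1 : (1 : K) ∈ span ℤ ({2, θ, θ ^ 2} : Set K) := by
      have h1Λ : (1 : K) ∈ L * span ℤ ({1, θ, θ ^ 2} : Set K) := by rw [hLΛ]; exact one_mem_span₁ θ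
      exact spanP_mul_span₁_le hθ hli (mul_le_mul' hLP le_rfl h1Λ)
    have h100 : ((1 : ℤ) : K) + (0 : ℤ) * θ + (0 : ℤ) * θ ^ 2 = 1 := by push_cast; ring
    have := (mem_spanP_iff hli 1 0 0).1 (by rw [h100]; exact h1)
    omega
  have hVstab : ∀ r : ZMod 2 × ZMod 2 × ZMod 2, (∀ t ∈ V, mul r t ∈ V) →
      r = ((0 : ZMod 2), (0 : ZMod 2), (0 : ZMod 2)) ∨ r = ((1 : ZMod 2), (0 : ZMod 2), (0 : ZMod 2)) := by
    intro r hr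
    -- lift `r` to `R ∈ Λ₁`; `R ∈ 𝒪(L) = Λ₃`
    have hcast : ∀ x : ZMod 2, (((x.val : ℕ) : ℤ) : ZMod 2) = x := fun x => by
      rw [Int.cast_natCast, ZMod.natCast_zmod_val]
    have hR : (((r.1.val : ℕ) : ℤ) : K) + (((r.2.1.val : ℕ) : ℤ) : K) * θ + (((r.2.2.val : ℕ) : ℤ) : K) * θ ^ 2 ∈
        L / L := by
      refine mem_div_iff_forall_mul_mem.2 fun x hx => ?_
      obtain ⟨u, v, w, rfl⟩ := exists_coords_of_mem_span₁ (hsub hx)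
      rw [hprod]
      refine (hV _ _ _).2 ?_
      rw [hmulres, hcast, hcast, hcast]
      exact hr _ ((hV u v w).1 hx)
    rw [hO, mem_span₃_iff hli] at hR
    obtain ⟨hb, hc⟩ := hR
    have hb' : r.2.1 = 0 := by
      rw [← hcast r.2.1]; exact (ZMod.intCast_zmod_eq_zero_iff_dvd _ 2).2 hb
    have hc' : r.2.2 = 0 := by
      rw [← hcast r.2.2]; exact (ZMod.intCast_zmod_eq_zero_iff_dvd _ 2).2 hc
    have h01 : ∀ z : ZMod 2, z = 0 ∨ z = 1 := by decide
    rcases h01 r.1 with ha | ha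
    · left; exact Prod.ext ha (Prod.ext hb' hc')
    · right; exact Prod.ext ha (Prod.ext hb' hc')
  -- (f) the finite classification
  have D : ∀ W : Finset (ZMod 2 × ZMod 2 × ZMod 2), ((0 : ZMod 2), (0 : ZMod 2), (0 : ZMod 2)) ∈ W →
      (∀ t ∈ W, ∀ t' ∈ W, t + t' ∈ W) → (∃ t ∈ W, t.1 = 1) →
      (∀ r : ZMod 2 × ZMod 2 × ZMod 2, (∀ t ∈ W, mul r t ∈ W) →
        r = ((0 : ZMod 2), (0 : ZMod 2), (0 : ZMod 2)) ∨ r = ((1 : ZMod 2), (0 : ZMod 2), (0 : ZMod 2))) →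
      ∃ e ∈ ({((1 : ZMod 2), (0 : ZMod 2), (0 : ZMod 2)), ((1 : ZMod 2), (1 : ZMod 2), (0 : ZMod 2)),
          ((1 : ZMod 2), (0 : ZMod 2), (1 : ZMod 2)), ((1 : ZMod 2), (1 : ZMod 2), (1 : ZMod 2))} :
          Finset (ZMod 2 × ZMod 2 × ZMod 2)),
        (∀ t, t ∈ W.image (mul e) ↔ (t.2.1 = 0 ∧ t.2.2 = 0)) ∨ (∀ t, t ∈ W.image (mul e) ↔ t.2.2 = 0) := by
    set_option synthInstance.maxSize 8000 in
    set_option synthInstance.maxHeartbeats 400000 in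
    decide +kernel
  -- injectivity of multiplication by a unit residue
  have hinj : ∀ e ∈ ({((1 : ZMod 2), (0 : ZMod 2), (0 : ZMod 2)), ((1 : ZMod 2), (1 : ZMod 2), (0 : ZMod 2)),
      ((1 : ZMod 2), (0 : ZMod 2), (1 : ZMod 2)), ((1 : ZMod 2), (1 : ZMod 2), (1 : ZMod 2))} :
      Finset (ZMod 2 × ZMod 2 × ZMod 2)), ∀ s t, mul e s = mul e t → s = t := by
    set_option synthInstance.maxSize 8000 in
    decide +kernel
  obtain ⟨e, heU, he⟩ := D V hV0 hVadd hVunit hVstab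
  -- (g) a unit `g = a + bθ + cθ²` of `Λ₁` with residue `e`, and its inverse `g' = a' + b'θ + c'θ²`
  have hg : ∃ a b c a' b' c' : ℤ, ((a : ZMod 2), (b : ZMod 2), (c : ZMod 2)) = e ∧
      ((a : K) + b * θ + c * θ ^ 2) * ((a' : K) + b' * θ + c' * θ ^ 2) = 1 := by
    simp only [Finset.mem_insert, Finset.mem_singleton] at heU
    rcases heU with rfl | rfl | rfl | rfl
    · exact ⟨1, 0, 0, 1, 0, 0, by push_cast; exact Prod.ext rfl (Prod.ext rfl rfl), by push_cast; ring⟩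
    · exact ⟨1, 1, 0, -1, -1, -1, by push_cast; exact Prod.ext rfl (Prod.ext rfl rfl),
        by push_cast; linear_combination (-1 : K) * hβ⟩
    · refine ⟨1, 2, 1, 1, 0, 1, ?_, by push_cast; linear_combination θ * hβ⟩
      refine Prod.ext rfl (Prod.ext ?_ rfl)
      show ((2 : ℤ) : ZMod 2) = 0
      decide
    · refine ⟨-1, 1, 1, -3, -1, -2, ?_, by push_cast; linear_combination (1 - 2 * θ) * hβ⟩
      refine Prod.ext ?_ (Prod.ext rfl rfl)
      show ((-1 : ℤ) : ZMod 2) = 1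
      decide
  obtain ⟨a, b, c, a', b', c', hres, hgg'⟩ := hg
  have hg0 : (a : K) + b * θ + c * θ ^ 2 ≠ 0 := left_ne_zero_of_mul_eq_one hgg'
  let g : Kˣ := Units.mk0 _ hg0
  have hginv : ((g⁻¹ : Kˣ) : K) = (a' : K) + b' * θ + c' * θ ^ 2 := by
    rw [Units.val_inv_eq_inv_val, Units.val_mk0]
    exact inv_eq_of_mul_eq_one_right hgg'
  -- membership in `g • L`
  have hmem : ∀ x : K, x ∈ g • L ↔ ((a' : K) + b' * θ + c' * θ ^ 2) * x ∈ L := fun x => by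
    rw [mem_units_smul_submodule_iff, Units.smul_def, smul_eq_mul, hginv]
  -- residues of `g'x` and `x = g(g'x)`
  have hback : ∀ u v w : ℤ, ((a : K) + b * θ + c * θ ^ 2) * (((a' : K) + b' * θ + c' * θ ^ 2) *
      ((u : K) + v * θ + w * θ ^ 2)) = (u : K) + v * θ + w * θ ^ 2 := fun u v w => by
    rw [← mul_assoc, hgg', one_mul]
  refine ⟨g, he.imp (fun hA => ?_) (fun hB => ?_)⟩
  · -- `g • L = Λ₃`
    ext x
    rw [hmem]
    constructor
    · intro hx
      -- `x = g · (g' x)` with `g' x ∈ L ⊆ Λ₁`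
      obtain ⟨u, v, w, huvw⟩ := exists_coords_of_mem_span₁ (hsub hx)
      have hxe : x = ((a : K) + b * θ + c * θ ^ 2) * ((u : K) + v * θ + w * θ ^ 2) := by
        rw [← huvw, ← mul_assoc, hgg', one_mul]
      have ht : ((u : ZMod 2), (v : ZMod 2), (w : ZMod 2)) ∈ V := (hV u v w).1 (huvw ▸ hx)
      have himg := (hA (mul e ((u : ZMod 2), (v : ZMod 2), (w : ZMod 2)))).1
        (Finset.mem_image.2 ⟨_, ht, rfl⟩)
      rw [hxe, hprod, mem_span₃_iff hli]
      have hr := hmulres a b c u v w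
      rw [hres] at hr
      rw [← hr] at himg
      exact ⟨(ZMod.intCast_zmod_eq_zero_iff_dvd _ 2).1 himg.1, (ZMod.intCast_zmod_eq_zero_iff_dvd _ 2).1 himg.2⟩
    · intro hx
      obtain ⟨u, v, w, rfl⟩ := exists_coords_of_mem_span₁ (span₂_le_span₁ θ (span₃_le_span₂ θ hx))
      obtain ⟨hv2, hw2⟩ := (mem_span₃_iff hli u v w).1 hx
      -- the residue of `x` lies in the image, `= mul e t` with `t ∈ V`
      have hxres : ((u : ZMod 2), (v : ZMod 2), (w : ZMod 2)) ∈ V.image (mul e) :=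
        (hA _).2 ⟨(ZMod.intCast_zmod_eq_zero_iff_dvd v 2).2 hv2, (ZMod.intCast_zmod_eq_zero_iff_dvd w 2).2 hw2⟩
      obtain ⟨t, htV, hte⟩ := Finset.mem_image.1 hxres
      -- `g' x ∈ Λ₁` with residue `s`, and `mul e s = res x = mul e t`, so `s = t ∈ V`
      have hg'x : ((a' : K) + b' * θ + c' * θ ^ 2) * ((u : K) + v * θ + w * θ ^ 2) ∈
          span ℤ ({1, θ, θ ^ 2} : Set K) :=
        span₁_mul_le hβ (mul_mem_mul (mem_span_triple.2 ⟨a', b', c', by simp only [zsmul_eq_mul, mul_one]⟩)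
          (mem_span_triple.2 ⟨u, v, w, by simp only [zsmul_eq_mul, mul_one]⟩))
      obtain ⟨p, q, r, hpqr⟩ := exists_coords_of_mem_span₁ hg'x
      have hxback : ((a : K) + b * θ + c * θ ^ 2) * ((p : K) + q * θ + r * θ ^ 2) = (u : K) + v * θ + w * θ ^ 2 := by
        rw [← hpqr]; exact hback u v w
      -- residues: `mul e (p,q,r) = (u,v,w)`
      have hs : mul e ((p : ZMod 2), (q : ZMod 2), (r : ZMod 2)) = ((u : ZMod 2), (v : ZMod 2), (w : ZMod 2)) := by
        rw [← hres, ← hmulres]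
        rw [hprod] at hxback
        push_cast at hxback
        obtain ⟨h1, h2', h3'⟩ := coeff_eq_zero₃ hli (a := a * p - 2 * (b * r + c * q) + 4 * c * r - u)
          (b := a * q + b * p - 2 * (b * r + c * q) + 2 * c * r - v)
          (c := a * r + b * q + c * p - 2 * (b * r + c * q) + 2 * c * r - w) (by push_cast; linear_combination hxback)
        refine Prod.ext ?_ (Prod.ext ?_ ?_)
        · show ((a * p - 2 * (b * r + c * q) + 4 * c * r : ℤ) : ZMod 2) = (u : ZMod 2)
          rw [show a * p - 2 * (b * r + c * q) + 4 * c * r = u by omega]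
        · show ((a * q + b * p - 2 * (b * r + c * q) + 2 * c * r : ℤ) : ZMod 2) = (v : ZMod 2)
          rw [show a * q + b * p - 2 * (b * r + c * q) + 2 * c * r = v by omega]
        · show ((a * r + b * q + c * p - 2 * (b * r + c * q) + 2 * c * r : ℤ) : ZMod 2) = (w : ZMod 2)
          rw [show a * r + b * q + c * p - 2 * (b * r + c * q) + 2 * c * r = w by omega]
      have hst : ((p : ZMod 2), (q : ZMod 2), (r : ZMod 2)) = t := hinj e heU _ _ (hs.trans hte.symm)
      rw [hpqr]
      exact (hV p q r).2 (hst ▸ htV)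
  · -- `g • L = L₃`
    ext x
    rw [hmem]
    constructor
    · intro hx
      obtain ⟨u, v, w, huvw⟩ := exists_coords_of_mem_span₁ (hsub hx)
      have hxe : x = ((a : K) + b * θ + c * θ ^ 2) * ((u : K) + v * θ + w * θ ^ 2) := by
        rw [← huvw, ← mul_assoc, hgg', one_mul]
      have ht : ((u : ZMod 2), (v : ZMod 2), (w : ZMod 2)) ∈ V := (hV u v w).1 (huvw ▸ hx)
      have himg := (hB (mul e ((u : ZMod 2), (v : ZMod 2), (w : ZMod 2)))).1
        (Finset.mem_image.2 ⟨_, ht, rfl⟩)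
      rw [hxe, hprod, mem_spanL₃_iff hli]
      have hr := hmulres a b c u v w
      rw [hres] at hr
      rw [← hr] at himg
      exact (ZMod.intCast_zmod_eq_zero_iff_dvd _ 2).1 himg
    · intro hx
      obtain ⟨u, v, w, rfl⟩ := exists_coords_of_mem_span₁ (spanL₃_le_span₁ θ hx)
      have hw2 := (mem_spanL₃_iff hli u v w).1 hx
      have hxres : ((u : ZMod 2), (v : ZMod 2), (w : ZMod 2)) ∈ V.image (mul e) :=
        (hB _).2 ((ZMod.intCast_zmod_eq_zero_iff_dvd w 2).2 hw2)
      obtain ⟨t, htV, hte⟩ := Finset.mem_image.1 hxres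
      have hg'x : ((a' : K) + b' * θ + c' * θ ^ 2) * ((u : K) + v * θ + w * θ ^ 2) ∈
          span ℤ ({1, θ, θ ^ 2} : Set K) :=
        span₁_mul_le hβ (mul_mem_mul (mem_span_triple.2 ⟨a', b', c', by simp only [zsmul_eq_mul, mul_one]⟩)
          (mem_span_triple.2 ⟨u, v, w, by simp only [zsmul_eq_mul, mul_one]⟩))
      obtain ⟨p, q, r, hpqr⟩ := exists_coords_of_mem_span₁ hg'x
      have hxback : ((a : K) + b * θ + c * θ ^ 2) * ((p : K) + q * θ + r * θ ^ 2) = (u : K) + v * θ + w * θ ^ 2 := by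
        rw [← hpqr]; exact hback u v w
      have hs : mul e ((p : ZMod 2), (q : ZMod 2), (r : ZMod 2)) = ((u : ZMod 2), (v : ZMod 2), (w : ZMod 2)) := by
        rw [← hres, ← hmulres]
        rw [hprod] at hxback
        push_cast at hxback
        obtain ⟨h1, h2', h3'⟩ := coeff_eq_zero₃ hli (a := a * p - 2 * (b * r + c * q) + 4 * c * r - u)
          (b := a * q + b * p - 2 * (b * r + c * q) + 2 * c * r - v)
          (c := a * r + b * q + c * p - 2 * (b * r + c * q) + 2 * c * r - w) (by push_cast; linear_combination hxback)
        refine Prod.ext ?_ (Prod.ext ?_ ?_)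
        · show ((a * p - 2 * (b * r + c * q) + 4 * c * r : ℤ) : ZMod 2) = (u : ZMod 2)
          rw [show a * p - 2 * (b * r + c * q) + 4 * c * r = u by omega]
        · show ((a * q + b * p - 2 * (b * r + c * q) + 2 * c * r : ℤ) : ZMod 2) = (v : ZMod 2)
          rw [show a * q + b * p - 2 * (b * r + c * q) + 2 * c * r = v by omega]
        · show ((a * r + b * q + c * p - 2 * (b * r + c * q) + 2 * c * r : ℤ) : ZMod 2) = (w : ZMod 2)
          rw [show a * r + b * q + c * p - 2 * (b * r + c * q) + 2 * c * r = w by omega]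
      have hst : ((p : ZMod 2), (q : ZMod 2), (r : ZMod 2)) = t := hinj e heU _ _ (hs.trans hte.symm)
      rw [hpqr]
      exact (hV p q r).2 (hst ▸ htV)

/-- **Every full lattice `L` with `𝒪(L) = Λ₃` is `Λ₃` or `L₃` up to a unit of `K`: `∃ u ∈ K^{unit}`, `uL = Λ₃` or
`uL = L₃`** («`{[L]_w | 𝒪(L) = Λ_3} = {[Λ_3]_w, [L_3]_w}`» together with `|G([Λ_3]_ε)| = 1`). First `LΛ₁ = cΛ₁`
(class number one), then the normalised case. [cite: HertlingLarabi2026b, §8 («`τ_3 = 2`», (8.1)), chunk p0024] -/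
theorem exists_units_smul_eq_span₃_or_spanL₃ (hθ : aeval θ (MonicCubic.poly 2 2 2) = 0) (h3 : finrank ℚ K = 3)
    {L : Submodule ℤ K} (hL : IsFullLattice K L) (hO : L / L = span ℤ ({1, 2 * θ, 2 * θ ^ 2} : Set K)) :
    ∃ u : Kˣ, u • L = span ℤ ({1, 2 * θ, 2 * θ ^ 2} : Set K) ∨ u • L = span ℤ ({1, θ, 2 * θ ^ 2} : Set K) := by
  have hβ := theta_rel_two hθ
  -- `LΛ₁` is a full lattice stable under `Λ₁`, hence principal
  have hst : ∀ m ∈ L * span ℤ ({1, θ, θ ^ 2} : Set K), ∀ a ∈ span ℤ ({1, θ, θ ^ 2} : Set K),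
      m * a ∈ L * span ℤ ({1, θ, θ ^ 2} : Set K) := fun m hm a ha => by
    have h : L * span ℤ ({1, θ, θ ^ 2} : Set K) * span ℤ ({1, θ, θ ^ 2} : Set K) ≤
        L * span ℤ ({1, θ, θ ^ 2} : Set K) := by
      rw [mul_assoc]; exact mul_le_mul' le_rfl (span₁_mul_le hβ)
    exact h (mul_mem_mul hm ha)
  obtain ⟨c, hc⟩ := exists_units_smul_span₁_eq hθ h3 (isFullLattice_mul hL (isFullLattice_span₁ hθ h3)) hst
  -- normalise: `L' = c⁻¹L` has `L'Λ₁ = Λ₁` and `𝒪(L') = Λ₃`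
  have hL'Λ : (c⁻¹ • L) * span ℤ ({1, θ, θ ^ 2} : Set K) = span ℤ ({1, θ, θ ^ 2} : Set K) := by
    rw [← units_smul_mul, ← hc, inv_smul_smul]
  have hO' : (c⁻¹ • L) / (c⁻¹ • L) = span ℤ ({1, 2 * θ, 2 * θ ^ 2} : Set K) := by
    rw [div_self_units_smul, hO]
  obtain ⟨v, hv⟩ := exists_units_smul_eq_of_mul_span₁_eq hθ h3 hL'Λ hO'
  refine ⟨v * c⁻¹, ?_⟩
  rw [mul_smul]
  exact hv

/-! ## §3 `#{[L]_ε | 𝒪(L) = Λ₃} = 2` -/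

/-- **`#{[L]_ε | 𝒪(L) = Λ₃} = 2`: the `ε`-classes of full lattices with order `Λ₃` are exactly `[Λ₃]_ε` and `[L₃]_ε`**
(`τ_3 · |G([Λ_3]_ε)| = 2 · 1`). With `natCard_quot_span₁_eq_one`, `natCard_quot_span₂_eq_one`, `natCard_quot_span₄_eq_two`
this completes HL's six classes `[Λ_1], [Λ_2], [Λ_3], [L_3], [Λ_4], [L_4]`.
[cite: HertlingLarabi2026b, §8 («`τ_3 = 2`», «It will turn out to have six elements»), chunks p0024–p0025] -/
theorem natCard_quot_span₃_eq_two (hθ : aeval θ (MonicCubic.poly 2 2 2) = 0) (h3 : finrank ℚ K = 3) :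
    Nat.card (Quot fun L L' : {L : Submodule ℤ K //
        IsFullLattice K L ∧ L / L = span ℤ ({1, 2 * θ, 2 * θ ^ 2} : Set K)} => ∃ u : Kˣ, u • L.1 = L'.1) = 2 := by
  have hβ := theta_rel_two hθ
  have hli := linearIndependent_one_theta_sq hθ h3
  -- the relation is an equivalence
  have hequiv : Equivalence fun L L' : {L : Submodule ℤ K //
      IsFullLattice K L ∧ L / L = span ℤ ({1, 2 * θ, 2 * θ ^ 2} : Set K)} => ∃ u : Kˣ, u • L.1 = L'.1 :=
    { refl := fun L => ⟨1, one_smul _ _⟩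
      symm := fun {L L'} ⟨u, hu⟩ => ⟨u⁻¹, by rw [← hu, inv_smul_smul]⟩
      trans := fun {L L' L''} ⟨u, hu⟩ ⟨v, hv⟩ => ⟨v * u, by rw [mul_smul, hu, hv]⟩ }
  -- the two representatives `Λ₃` and `L₃`
  have hΛ₃O : span ℤ ({1, 2 * θ, 2 * θ ^ 2} : Set K) / span ℤ ({1, 2 * θ, 2 * θ ^ 2} : Set K) =
      span ℤ ({1, 2 * θ, 2 * θ ^ 2} : Set K) := div_self_eq_of_one_mem (one_mem_span₃ θ) (span₃_mul_le hβ)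
  have hΛ₃L₃ : span ℤ ({1, 2 * θ, 2 * θ ^ 2} : Set K) ≤ span ℤ ({1, θ, 2 * θ ^ 2} : Set K) := by
    refine span_le.2 ?_
    rintro x (rfl | rfl | rfl)
    · exact subset_span (by simp)
    · simpa [two_smul, two_mul] using (span ℤ ({1, θ, 2 * θ ^ 2} : Set K)).smul_mem (2 : ℤ)
        (subset_span (by simp) : θ ∈ span ℤ ({1, θ, 2 * θ ^ 2} : Set K))
    · exact subset_span (by simp)
  have hL₃full : IsFullLattice K (span ℤ ({1, θ, 2 * θ ^ 2} : Set K)) := by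
    refine ⟨fg_span (Set.toFinite _), fun d => ?_⟩
    obtain ⟨n, hn, hnd⟩ := (isFullLattice_span₃ hθ h3).2 d
    exact ⟨n, hn, hΛ₃L₃ hnd⟩
  let X : {L : Submodule ℤ K // IsFullLattice K L ∧ L / L = span ℤ ({1, 2 * θ, 2 * θ ^ 2} : Set K)} :=
    ⟨span ℤ ({1, 2 * θ, 2 * θ ^ 2} : Set K), isFullLattice_span₃ hθ h3, hΛ₃O⟩
  let Y : {L : Submodule ℤ K // IsFullLattice K L ∧ L / L = span ℤ ({1, 2 * θ, 2 * θ ^ 2} : Set K)} :=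
    ⟨span ℤ ({1, θ, 2 * θ ^ 2} : Set K), hL₃full, spanL₃_div_spanL₃ hβ hli⟩
  rw [Nat.card_eq_two_iff]
  refine ⟨Quot.mk _ X, Quot.mk _ Y, fun h => ?_, Set.eq_univ_iff_forall.2 ?_⟩
  · obtain ⟨u, hu⟩ := (hequiv.eqvGen_iff).1 (Quot.eqvGen_exact h)
    exact not_exists_units_smul_span₃_eq_spanL₃ hθ h3 ⟨u, hu⟩
  · rintro ⟨L⟩
    obtain ⟨u, hu | hu⟩ := exists_units_smul_eq_span₃_or_spanL₃ hθ h3 L.2.1 L.2.2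
    · exact Or.inl (Quot.sound ⟨u, hu⟩)
    · exact Or.inr (Quot.sound ⟨u, hu⟩)

end Literature.NumberTheory.ComplexMultiplication.FiniteQAlgebraLattice.DTZCubic

end
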